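import Summits.BirchSwinnertonDyer.BirchSwinnertonDyer.Theses.LeadingTerm
import Summits.BirchSwinnertonDyer.BirchSwinnertonDyer.Theorems.PAdicOrderV2PAdicOrderComparisonR2StubParity
import Literature.NumberTheory.EllipticCurves.KatoRankBoundProofs
import HarnessLib

/-!
# BirchSwinnertonDyer / LeadingTerm — crux `Consistency` (stmt-BirchSwinnertonDyer-16217),
# line `Sketch`, stub S1m `stub_deficient_two_le_mismatch`: conditional closure

Registered stub S1m of the skeleton `Cruxes/Consistency/Lines/Sketch.lean`: for `E/ℚ` (globally
minimal `W`), a good ordinary prime `p ≥ 5`, the newform `f` of `E`, in the deficient cells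
`2 ≤ r_MW < r_an` of MISMATCHED parity (`Even r_MW ↔ Odd r_an`) the Taylor coefficient
`[T^{r_MW}] L_p(E,T)` of `L_p(E,T) = padicLFunction f (unitRoot W p)` vanishes.

This is KNOWN IN PRINT but not provable in the tree today: it rests on Kato's Euler-system
divisibility `char_Λ X(E/ℚ_∞) ∣ p^n L_p(E,T)` (Astérisque 295, Thm 17.4), the tree's named fact
`Literature.NumberTheory.EllipticCurves.kato_divisibility` (`PAdicBSD`, bsd.S20; a
`def … : Prop` without `_holds`). `stub_deficient_two_le_mismatch_of_kato_divisibility` records,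
machine-checked, that the stub FOLLOWS from (the ∀-closure of) that one named fact:

* Kato's rank bound `rank E(ℚ) ≤ ord_T L_p(E,T)` (Thm 18.4, "In particular") is the tree theorem
  `kato_mordellWeilRank_le_order_padicLFunction_of_kato_divisibility` (`KatoRankBoundProofs`),
  proved from `kato_divisibility` alone;
* the parities agree, `ord_T L_p ≡ r_an (mod 2)` (Greenberg, LNM 1716, §5: the signs of the two
  functional equations coincide), by the landed hypothesis-free stub
  `stub_even_order_iff_even_analyticRank` (stated with `order.toNat`; if `ord_T L_p = ⊤` then
  `L_p = 0` and every coefficient vanishes);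
* mismatched parity forces `ord_T L_p ≠ r_MW`, hence `r_MW < ord_T L_p`, and
  `PowerSeries.coeff_of_lt_order` closes.

The statement is in colon form `hkato → <registered stub signature>`, with fully qualified names,
and is registered as a sub-goal of the crux (`ledger workitem stub-add`). The hypotheses `2 ≤ r_MW`
and `r_MW < r_an` of the registered signature are not used by the proof.
-/

set_option linter.dupNamespace false

namespace Summit.BirchSwinnertonDyer.BirchSwinnertonDyer.Theorems

open scoped MatrixGroups ModularForm
open CongruenceSubgroup Literature.NumberTheory.EllipticCurves
  Literature.NumberTheory.EllipticCurves.ModularForms WeierstrassCurve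

/-- **Stub S1m from Kato's divisibility (Thm 17.4) alone.** Colon form: the antecedent is the
∀-closure of the named fact `Literature.NumberTheory.EllipticCurves.kato_divisibility` over its
section variables `W, p, κ, γ, N, f` (the same term as in
`pAdicOrderKatoSideR2_of_kato_divisibility`); the consequent is the registered stub
`stub_deficient_two_le_mismatch` of line `Sketch` verbatim (names fully qualified). Proof: Kato's
bound `r_MW ≤ ord_T L_p` (Thm 18.4, tree theorem
`kato_mordellWeilRank_le_order_padicLFunction_of_kato_divisibility`; `p ≠ 2` from `5 ≤ p`), the
parity `ord_T L_p ≡ r_an (mod 2)` (`stub_even_order_iff_even_analyticRank`, Greenberg LNM 1716 §5)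
and the mismatch `r_MW ≢ r_an (mod 2)` give `r_MW < ord_T L_p`, so the `r_MW`-th coefficient
vanishes (`PowerSeries.coeff_of_lt_order`); if `ord_T L_p = ⊤` then `L_p = 0`.
[cite: Kato2004Asterisque, Thm 18.4 (p. 281)] [cite: GreenbergLNM1716, §5 (p. 181)] -/
theorem stub_deficient_two_le_mismatch_of_kato_divisibility :
    (∀ (W : WeierstrassCurve ℚ) [W.IsElliptic] [W.IsGloballyMinimal] (p : ℕ) [Fact p.Prime]
      (κ : Literature.NumberTheory.EllipticCurves.ZpExtension ℚ p) (γ : Field.absoluteGaloisGroup ℚ)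
      {N : ℕ} [NeZero N] (f : CuspForm (CongruenceSubgroup.Gamma0 N) 2),
      Literature.NumberTheory.EllipticCurves.kato_divisibility W p (κ := κ) (γ := γ) (f := f)) →
    ∀ (W : WeierstrassCurve ℚ) [W.IsElliptic] [W.IsGloballyMinimal] (p : ℕ) [Fact p.Prime],
      5 ≤ p → Literature.NumberTheory.EllipticCurves.IsOrdinaryAt W p →
      ∀ {N : ℕ} [NeZero N] (f : CuspForm (CongruenceSubgroup.Gamma0 N) 2),
        Literature.NumberTheory.EllipticCurves.ModularForms.IsNewformOf W f →
        2 ≤ W.mordellWeilRank → W.mordellWeilRank < W.analyticRank →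
          (Even W.mordellWeilRank ↔ Odd W.analyticRank) →
          PowerSeries.coeff W.mordellWeilRank
              (Literature.NumberTheory.EllipticCurves.padicLFunction f
                (Literature.NumberTheory.EllipticCurves.unitRoot W p : ℚ_[p])) = 0 := by
  intro hkato W _ _ p _ h5 hord N _ f hf _ _ hpar
  -- Kato Thm 18.4: `r_MW ≤ ord_T L_p` (in `ℕ∞`)
  have hle : (W.mordellWeilRank : ℕ∞) ≤ (padicLFunction f (unitRoot W p : ℚ_[p])).order :=
    kato_mordellWeilRank_le_order_padicLFunction_of_kato_divisibility W p
      (fun κ γ ↦ hkato W p κ γ f) (by omega) hord hf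
  -- the two functional equations have the same sign: `ord_T L_p ≡ r_an (mod 2)`
  have hparity := stub_even_order_iff_even_analyticRank W p hord f hf
  by_cases htop : (padicLFunction f (unitRoot W p : ℚ_[p])).order = ⊤
  · rw [PowerSeries.order_eq_top.mp htop, map_zero]
  · obtain ⟨n, hn⟩ := ENat.ne_top_iff_exists.mp htop
    rw [← hn] at hle hparity
    rw [ENat.toNat_coe] at hparity
    have hle' : W.mordellWeilRank ≤ n := by exact_mod_cast hle
    have hne : W.mordellWeilRank ≠ n := by
      rintro rfl
      simp only [Nat.even_iff, Nat.odd_iff] at hpar hparity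
      omega
    refine PowerSeries.coeff_of_lt_order _ ?_
    rw [← hn]
    exact_mod_cast lt_of_le_of_ne hle' hne

/-! ### Second instalment (lead, 2026-08-16): S1m from the route's own crux #5

Route rev 7 (route-choice rchoice-21fcbdc6) attached Kato's rank bound in item form to route
`LeadingTerm` as crux #5 `PAdicOrderKatoSideR2` (stmt-BirchSwinnertonDyer-0491:
`p ≠ 2 → IsOrdinaryAt W p → IsNewformOf W f → (r_MW : ℕ∞) ≤ ord_T L_p`). Relative to that ITEM
(an admissible hypothesis of the line's composition) stub S1m is a theorem: the same three lines
as above with the item in place of the named fact. -/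

/-- **Stub S1m from the route item `PAdicOrderKatoSideR2`** (Kato's rank bound
`rank E(ℚ) ≤ ord_T L_p(E,T)` as an item of route `LeadingTerm`, stmt-BirchSwinnertonDyer-0491):
in a deficient cell `2 ≤ r_MW < r_an` of mismatched parity, `r_MW ≤ ord_T L_p` (the item, at
`p ≠ 2`), `ord_T L_p ≡ r_an (mod 2)` (`stub_even_order_iff_even_analyticRank`, Greenberg LNM 1716
§5) and `r_MW ≢ r_an (mod 2)` give `r_MW < ord_T L_p`, so `[T^{r_MW}]L_p = 0`
(`PowerSeries.coeff_of_lt_order`; if `ord_T L_p = ⊤` then `L_p = 0`). The consequent is the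
registered stub `stub_deficient_two_le_mismatch` of line `Sketch` verbatim.
[cite: Kato2004Asterisque, Thm 18.4 (p. 281)] [cite: GreenbergLNM1716, §5 (p. 181)] -/
theorem stub_deficient_two_le_mismatch_of_katoSide :
    Summit.BirchSwinnertonDyer.BirchSwinnertonDyer.Theses.LeadingTerm.PAdicOrderKatoSideR2 →
    ∀ (W : WeierstrassCurve ℚ) [W.IsElliptic] [W.IsGloballyMinimal] (p : ℕ) [Fact p.Prime],
      5 ≤ p → Literature.NumberTheory.EllipticCurves.IsOrdinaryAt W p →
      ∀ {N : ℕ} [NeZero N] (f : CuspForm (CongruenceSubgroup.Gamma0 N) 2),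
        Literature.NumberTheory.EllipticCurves.ModularForms.IsNewformOf W f →
        2 ≤ W.mordellWeilRank → W.mordellWeilRank < W.analyticRank →
          (Even W.mordellWeilRank ↔ Odd W.analyticRank) →
          PowerSeries.coeff W.mordellWeilRank
              (Literature.NumberTheory.EllipticCurves.padicLFunction f
                (Literature.NumberTheory.EllipticCurves.unitRoot W p : ℚ_[p])) = 0 := by
  intro hK W _ _ p _ h5 hord N _ f hf _ _ hpar
  -- the item: `r_MW ≤ ord_T L_p` (in `ℕ∞`)
  have hle : (W.mordellWeilRank : ℕ∞) ≤ (padicLFunction f (unitRoot W p : ℚ_[p])).order :=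
    hK W p (by omega) hord f hf
  -- the two functional equations have the same sign: `ord_T L_p ≡ r_an (mod 2)`
  have hparity := stub_even_order_iff_even_analyticRank W p hord f hf
  by_cases htop : (padicLFunction f (unitRoot W p : ℚ_[p])).order = ⊤
  · rw [PowerSeries.order_eq_top.mp htop, map_zero]
  · obtain ⟨n, hn⟩ := ENat.ne_top_iff_exists.mp htop
    rw [← hn] at hle hparity
    rw [ENat.toNat_coe] at hparity
    have hle' : W.mordellWeilRank ≤ n := by exact_mod_cast hle
    have hne : W.mordellWeilRank ≠ n := by
      rintro rfl
      simp only [Nat.even_iff, Nat.odd_iff] at hpar hparity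
      omega
    refine PowerSeries.coeff_of_lt_order _ ?_
    rw [← hn]
    exact_mod_cast lt_of_le_of_ne hle' hne

end Summit.BirchSwinnertonDyer.BirchSwinnertonDyer.Theorems
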